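import Literature.Analysis.ValidatedNumerics.TaylorModelIntegralCert2DElem
import HarnessLib

/-!
# Adaptive (kd-tree) certificates for double integrals over boxes

Trunk T-ANA (Analysis/ValidatedNumerics); namespace `Literature.Analysis.ValidatedNumerics.PolyMP`.
Sequel of `TaylorModelIntegralCert2D.lean` (the box estimate `abs_integral2_sub_integ2Q_le`, `integ2Q`, `midRows`,
`boxErr`) and `TaylorModelIntegralCert2DElem.lean` (the box rule `boxEnclG`, the expression language `BExprE` with
`BExprE.model` / `tmem2_model`, the parameters `EPrm`).  Those files certify `∫∫ f` over a UNIFORM `n × m` grid of boxes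
of one size and one degree.  Verified quadrature in the Taylor-model literature and in CoqInterval is ADAPTIVE: the
domain is split where the enclosure is too wide and left coarse where it is tight (Makino–Berz 2003, Algorithm 2 over a
partition of the domain box; Mahboubi–Melquiond–Sibut-Pinote 2016, Sect. 3.3: the integration domain is split recursively
and the enclosures of the pieces are added).  This file makes the partition a first-class certificate datum:

* `Box2Q` — a rational box `[x0, x1] × [y0, y1]`; `KdTree2` — a kd-tree whose leaves carry their OWN parameters `EPrm`
  (degree, series orders) and their claimed enclosure `J : MI`, and whose inner nodes split the current box at a rational
  abscissa (`splitX c`) or ordinate (`splitY c`); `KdTree2.leaves t B` lists the leaf boxes, `KdTree2.total t` adds the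
  claims;
* **Part A, generic in a box modeller** `Ψ : (h k cx cy : ℚ) → EPrm → IPoly2 × Bool` (model of `(u, v) ↦ f(cx+u, cy+v)` on
  `|u| ≤ h, |v| ≤ k` with acceptance flag): the leaf rule `leafEncl` (= `boxEnclG` of the leaf's own half-widths and
  centre, flag also requiring `x0 ≤ x1`, `y0 ≤ y1`), its soundness in absolute coordinates, the kernel obligations
  `leafCheckG … i` (leaf `i` accepted and inside its claim — ONE `decide` per leaf), the final obligation `treeCheckG`
  (positivity of `S`, leaf count, `Σ claims ⊆ [lo·S, hi·S]`), and **`integral_bounds_of_leafCheckG`**, proved by structural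
  induction on the tree: additivity of the interval integral across an `x`-split, additivity on every `x`-section across a
  `y`-split;
* **Part B** for `BExprE` integrands: `leafCheckE` / `treeCheckE` / **`integral_bounds_of_leafCheckE (hleaf) (ht) :
  lo ≤ ∫_{x0}^{x1} ∫_{y0}^{y1} E(x, y) dy dx ≤ hi`** with no side hypotheses;
* **Part C — a refinement heuristic** `kdRefine` (computable, soundness-free: it PROPOSES a tree by bisecting the longer
  side of every box whose scaled error exceeds a tolerance, up to a depth; the certificate is then checked leaf by leaf).

Problem-independent; no facts, no axioms; all certificate data computable over `ℤ`.

## References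

* K. Makino, M. Berz, *Taylor models and other validated functional inclusion methods*, Int. J. Pure Appl. Math. 4
  (2003) 379–456, Algorithm 2 (quadrature with Taylor models over a partition of the domain box: `∫_D f ⊂ Σ_boxes (∫ P + |box| · I)`).
  [cite: MakinoBerz2003, Algorithm 2]
* M. Berz, K. Makino, *New methods for high-dimensional verified quadrature*, Reliable Computing 5 (1999) 13–22, Sect. 2.
  [cite: BerzMakino1999, Sect. 2]
* A. Mahboubi, G. Melquiond, T. Sibut-Pinote, *Formally verified approximations of definite integrals*, ITP 2016, LNCS 9807,
  274–289, Sect. 3.3 (splitting of the integration domain, enclosures of the pieces added and checked by computation).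
  [cite: MahboubiMelquiondSibutpinote2016, Sect. 3.3]
* Additivity of the interval integral over adjacent intervals and translation invariance (Mathlib
  `intervalIntegral.integral_add_adjacent_intervals`, `intervalIntegral.integral_comp_add_left`). [folklore]
-/

open MeasureTheory intervalIntegral Set
open scoped Interval

namespace Literature.Analysis.ValidatedNumerics

namespace PolyMP

open Literature.Analysis.ValidatedNumerics.NumericsMP
open Literature.Analysis.ValidatedNumerics.ExpPoly (Poly)
open Literature.Analysis.ValidatedNumerics.ExpPoly

/-! ### Boxes and kd-trees -/

/-- A rational box `[x0, x1] × [y0, y1]`. [cite: MakinoBerz2003, Algorithm 2] -/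
structure Box2Q where
  /-- left abscissa -/
  x0 : ℚ
  /-- right abscissa -/
  x1 : ℚ
  /-- lower ordinate -/
  y0 : ℚ
  /-- upper ordinate -/
  y1 : ℚ

/-- **Adaptive certificate data**: a kd-tree over a box.  A leaf carries its own Taylor-model parameters and its CLAIMED
enclosure (scaled by `S`); an inner node splits the current box at `x = c` or at `y = c`.
[cite: MahboubiMelquiondSibutpinote2016, Sect. 3.3] [cite: MakinoBerz2003, Algorithm 2] -/
inductive KdTree2 : Type
  /-- a leaf box, modelled with parameters `P`, claimed enclosure `J` -/
  | leaf (P : EPrm) (J : MI) : KdTree2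
  /-- split the current box `[x0, x1] × [y0, y1]` into `[x0, c] × …` (tree `L`) and `[c, x1] × …` (tree `R`) -/
  | splitX (c : ℚ) (L R : KdTree2) : KdTree2
  /-- split the current box into `… × [y0, c]` (tree `L`) and `… × [c, y1]` (tree `R`) -/
  | splitY (c : ℚ) (L R : KdTree2) : KdTree2

namespace KdTree2

/-- The leaf boxes of a tree laid over the box `B`, in order, with their parameters and claims.
[cite: MahboubiMelquiondSibutpinote2016, Sect. 3.3] -/
def leaves : KdTree2 → Box2Q → List (Box2Q × EPrm × MI)
  | leaf P J, B => [(B, P, J)]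
  | splitX c L R, B => leaves L ⟨B.x0, c, B.y0, B.y1⟩ ++ leaves R ⟨c, B.x1, B.y0, B.y1⟩
  | splitY c L R, B => leaves L ⟨B.x0, B.x1, B.y0, c⟩ ++ leaves R ⟨B.x0, B.x1, c, B.y1⟩

/-- The sum of the claimed leaf enclosures. [cite: MahboubiMelquiondSibutpinote2016, Sect. 3.3] -/
def total : KdTree2 → MI
  | leaf _ J => J
  | splitX _ L R => MI.add (total L) (total R)
  | splitY _ L R => MI.add (total L) (total R)

/-- Number of leaves. [cite: MahboubiMelquiondSibutpinote2016, Sect. 3.3] -/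
def size : KdTree2 → ℕ
  | leaf _ _ => 1
  | splitX _ L R => size L + size R
  | splitY _ L R => size L + size R

/-- [cite: MahboubiMelquiondSibutpinote2016, Sect. 3.3] -/
theorem length_leaves : ∀ (t : KdTree2) (B : Box2Q), (t.leaves B).length = t.size
  | leaf _ _, _ => rfl
  | splitX c L R, B => by simp [leaves, size, length_leaves L, length_leaves R]
  | splitY c L R, B => by simp [leaves, size, length_leaves L, length_leaves R]

end KdTree2

/-! ### Part A. Leaf rule and certificate, generic in the box modeller -/

/-- **The leaf rule**: the Taylor-model box rule `boxEnclG` at the leaf's own centre and half-widths, for a modeller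
`Ψ h k cx cy P` = (model of `(u, v) ↦ f(cx + u, cy + v)` on `|u| ≤ h, |v| ≤ k` with parameters `P`, flag); the flag also
requires the box to be non-degenerate-or-empty in the right orientation (`x0 ≤ x1`, `y0 ≤ y1`).
[cite: MakinoBerz2003, Algorithm 2] -/
def leafEncl (S : ℕ) (Ψ : ℚ → ℚ → ℚ → ℚ → EPrm → IPoly2 × Bool) (B : Box2Q) (P : EPrm) : MI × Bool :=
  let h := (B.x1 - B.x0) / 2
  let k := (B.y1 - B.y0) / 2
  let b := boxEnclG S h k (fun cx cy => Ψ h k cx cy P) ((B.x0 + B.x1) / 2) ((B.y0 + B.y1) / 2)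
  (b.1, b.2 && decide (B.x0 ≤ B.x1) && decide (B.y0 ≤ B.y1))

/-- **Soundness shape of a modeller**: accepted models enclose the translated integrand on the box.
[cite: MakinoBerz2003, Algorithm 2] -/
def ModelSound (S : ℕ) (f : ℝ → ℝ → ℝ) (Ψ : ℚ → ℚ → ℚ → ℚ → EPrm → IPoly2 × Bool) : Prop :=
  ∀ (h k cx cy : ℚ) (P : EPrm), 0 ≤ h → 0 ≤ k → (Ψ h k cx cy P).2 = true →
    TMem2 S h k (fun u v => f ((cx : ℝ) + u) ((cy : ℝ) + v)) (Ψ h k cx cy P).1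

/-- What a sound enclosure of the integral over a box provides downstream: membership, integrability of the inner
integral, integrability of every section, and the orientation of the box. [folklore] -/
private def BoxClaim (S : ℕ) (f : ℝ → ℝ → ℝ) (B : Box2Q) (J : MI) : Prop :=
  MI.mem S (∫ x in (B.x0 : ℝ)..B.x1, ∫ y in (B.y0 : ℝ)..B.y1, f x y) J ∧
    IntervalIntegrable (fun x => ∫ y in (B.y0 : ℝ)..B.y1, f x y) volume (B.x0 : ℝ) B.x1 ∧
    (∀ x : ℝ, (B.x0 : ℝ) ≤ x → x ≤ B.x1 → IntervalIntegrable (fun y => f x y) volume (B.y0 : ℝ) B.y1) ∧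
    B.x0 ≤ B.x1 ∧ B.y0 ≤ B.y1

/-- **Soundness of the leaf rule** in absolute coordinates. [folklore] -/
private theorem leafEncl_sound {S : ℕ} (hS : 0 < S) {f : ℝ → ℝ → ℝ} (hf : Measurable fun z : ℝ × ℝ => f z.1 z.2)
    {Ψ : ℚ → ℚ → ℚ → ℚ → EPrm → IPoly2 × Bool} (hΨ : ModelSound S f Ψ) (B : Box2Q) (P : EPrm)
    (hok : (leafEncl S Ψ B P).2 = true) : BoxClaim S f B (leafEncl S Ψ B P).1 := by
  simp only [leafEncl, boxEnclG, Bool.and_eq_true, decide_eq_true_eq] at hok ⊢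
  obtain ⟨⟨hacc, hx⟩, hy⟩ := hok
  set h : ℚ := (B.x1 - B.x0) / 2 with hh
  set k : ℚ := (B.y1 - B.y0) / 2 with hk
  set cx : ℚ := (B.x0 + B.x1) / 2 with hcx
  set cy : ℚ := (B.y0 + B.y1) / 2 with hcy
  have h0 : 0 ≤ h := by rw [hh]; linarith
  have k0 : 0 ≤ k := by rw [hk]; linarith
  have hT := hΨ h k cx cy P h0 k0 hacc
  have hm : Measurable fun z : ℝ × ℝ => f ((cx : ℝ) + z.1) ((cy : ℝ) + z.2) :=
    hf.comp ((measurable_const.add measurable_fst).prodMk (measurable_const.add measurable_snd))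
  obtain ⟨hest, hI, hσ⟩ := abs_integral2_sub_integ2Q_le hS h0 k0 hm hT (midRows S (Ψ h k cx cy P).1)
  -- the translated limits
  have ex0 : (cx : ℝ) + -(h : ℝ) = (B.x0 : ℝ) := by rw [hcx, hh]; push_cast; ring
  have ex1 : (cx : ℝ) + (h : ℝ) = (B.x1 : ℝ) := by rw [hcx, hh]; push_cast; ring
  have ey0 : (cy : ℝ) + -(k : ℝ) = (B.y0 : ℝ) := by rw [hcy, hk]; push_cast; ring
  have ey1 : (cy : ℝ) + (k : ℝ) = (B.y1 : ℝ) := by rw [hcy, hk]; push_cast; ring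
  have einner : ∀ u : ℝ, (∫ v in (-(k : ℝ))..k, f ((cx : ℝ) + u) ((cy : ℝ) + v)) =
      ∫ y in (B.y0 : ℝ)..B.y1, f ((cx : ℝ) + u) y := by
    intro u
    rw [intervalIntegral.integral_comp_add_left (fun y => f ((cx : ℝ) + u) y) (cy : ℝ), ey0, ey1]
  simp_rw [einner] at hest hI
  have eouter : (∫ u in (-(h : ℝ))..h, ∫ y in (B.y0 : ℝ)..B.y1, f ((cx : ℝ) + u) y) =
      ∫ x in (B.x0 : ℝ)..B.x1, ∫ y in (B.y0 : ℝ)..B.y1, f x y := by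
    rw [intervalIntegral.integral_comp_add_left (fun x => ∫ y in (B.y0 : ℝ)..B.y1, f x y) (cx : ℝ), ex0, ex1]
  rw [eouter] at hest
  refine ⟨?_, ?_, ?_, hx, hy⟩
  · -- membership: exact integral of the midpoint rows widened by the scaled box error
    refine MI.mem_widen (mem_ofRat S _) ?_
    have hSr : (0 : ℝ) < S := by exact_mod_cast hS
    set Bd : ℤ := tabs2 S h k (tsub2 (Ψ h k cx cy P).1 (ratPoly2 S (midRows S (Ψ h k cx cy P).1))) with hBd
    have h1 := mul_le_mul_of_nonneg_right hest hSr.le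
    have h2 : (Bd : ℝ) / S * (2 * k) * (2 * h) * S = (((Bd : ℚ) * (4 * h * k) : ℚ) : ℝ) := by
      push_cast; field_simp; ring
    have h3 : (((Bd : ℚ) * (4 * h * k) : ℚ) : ℝ) ≤ (boxErr h k Bd : ℝ) := by
      unfold boxErr; exact_mod_cast Int.le_ceil _
    rw [h2] at h1
    exact h1.trans h3
  · -- integrability of the inner integral in `x`
    have h1 := hI.comp_sub_right (cx : ℝ)
    have e0 : (fun x => ∫ y in (B.y0 : ℝ)..B.y1, f ((cx : ℝ) + (x - (cx : ℝ))) y) =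
        fun x => ∫ y in (B.y0 : ℝ)..B.y1, f x y := by
      funext x; simp only [add_sub_cancel]
    have ea : -(h : ℝ) + (cx : ℝ) = (B.x0 : ℝ) := by rw [← ex0]; ring
    have eb : (h : ℝ) + (cx : ℝ) = (B.x1 : ℝ) := by rw [← ex1]; ring
    rw [e0, ea, eb] at h1
    exact h1
  · -- integrability of every section
    intro x hx0 hx1
    have hu : |x - (cx : ℝ)| ≤ h := by
      rw [abs_le]; constructor <;> linarith [ex0, ex1]
    have h1 := (hσ (x - cx) hu).comp_sub_right (cy : ℝ)
    have e0 : (fun y => f ((cx : ℝ) + (x - (cx : ℝ))) ((cy : ℝ) + (y - (cy : ℝ)))) = fun y => f x y := by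
      funext y; simp only [add_sub_cancel]
    have ea : -(k : ℝ) + (cy : ℝ) = (B.y0 : ℝ) := by rw [← ey0]; ring
    have eb : (k : ℝ) + (cy : ℝ) = (B.y1 : ℝ) := by rw [← ey1]; ring
    rw [e0, ea, eb] at h1
    exact h1

/-- Every leaf accepted and inside its claim (the conjunction the kernel obligations establish).
[cite: MahboubiMelquiondSibutpinote2016, Sect. 3.3] -/
def leafClaimsOK (S : ℕ) (Ψ : ℚ → ℚ → ℚ → ℚ → EPrm → IPoly2 × Bool) (ls : List (Box2Q × EPrm × MI)) : Bool :=
  ls.all fun l =>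
    let e := leafEncl S Ψ l.1 l.2.1
    e.2 && decide (l.2.2.lo ≤ e.1.lo) && decide (e.1.hi ≤ l.2.2.hi)

/-- **Soundness of a checked tree** (structural induction: a leaf by `leafEncl_sound` and monotonicity of membership; an
`x`-split by additivity over adjacent intervals; a `y`-split by additivity on every section and linearity of the outer
integral). [folklore] -/
private theorem tree_sound {S : ℕ} (hS : 0 < S) {f : ℝ → ℝ → ℝ} (hf : Measurable fun z : ℝ × ℝ => f z.1 z.2)
    {Ψ : ℚ → ℚ → ℚ → ℚ → EPrm → IPoly2 × Bool} (hΨ : ModelSound S f Ψ) :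
    ∀ (t : KdTree2) (B : Box2Q), leafClaimsOK S Ψ (t.leaves B) = true → BoxClaim S f B t.total
  | KdTree2.leaf P J, B, hok => by
      simp only [KdTree2.leaves, leafClaimsOK, List.all_cons, List.all_nil, Bool.and_true, Bool.and_eq_true,
        decide_eq_true_eq] at hok
      obtain ⟨⟨hacc, hlo⟩, hhi⟩ := hok
      obtain ⟨hm, hI, hσ, hx, hy⟩ := leafEncl_sound hS hf hΨ B P hacc
      refine ⟨⟨?_, ?_⟩, hI, hσ, hx, hy⟩
      · exact le_trans (by exact_mod_cast hlo) hm.1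
      · exact le_trans hm.2 (by exact_mod_cast hhi)
  | KdTree2.splitX c L R, B, hok => by
      simp only [KdTree2.leaves, leafClaimsOK, List.all_append, Bool.and_eq_true] at hok
      obtain ⟨hmL, hIL, hσL, hxL, hyL⟩ := tree_sound hS hf hΨ L ⟨B.x0, c, B.y0, B.y1⟩ hok.1
      obtain ⟨hmR, hIR, hσR, hxR, hyR⟩ := tree_sound hS hf hΨ R ⟨c, B.x1, B.y0, B.y1⟩ hok.2
      simp only at hmL hIL hσL hxL hyL hmR hIR hσR hxR hyR
      refine ⟨?_, hIL.trans hIR, ?_, hxL.trans hxR, hyL⟩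
      · rw [KdTree2.total, ← intervalIntegral.integral_add_adjacent_intervals hIL hIR]
        exact MI.mem_add hmL hmR
      · intro x h0 h1
        rcases le_total x (c : ℝ) with hc | hc
        · exact hσL x h0 hc
        · exact hσR x hc h1
  | KdTree2.splitY c L R, B, hok => by
      simp only [KdTree2.leaves, leafClaimsOK, List.all_append, Bool.and_eq_true] at hok
      obtain ⟨hmL, hIL, hσL, hxL, hyL⟩ := tree_sound hS hf hΨ L ⟨B.x0, B.x1, B.y0, c⟩ hok.1
      obtain ⟨hmR, hIR, hσR, hxR, hyR⟩ := tree_sound hS hf hΨ R ⟨B.x0, B.x1, c, B.y1⟩ hok.2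
      simp only at hmL hIL hσL hxL hyL hmR hIR hσR hxR hyR
      have hxx : (B.x0 : ℝ) ≤ B.x1 := by exact_mod_cast hxL
      -- additivity in `y` on every section
      have hsec : ∀ x : ℝ, (B.x0 : ℝ) ≤ x → x ≤ B.x1 →
          (∫ y in (B.y0 : ℝ)..c, f x y) + ∫ y in (c : ℝ)..B.y1, f x y = ∫ y in (B.y0 : ℝ)..B.y1, f x y :=
        fun x h0 h1 => intervalIntegral.integral_add_adjacent_intervals (hσL x h0 h1) (hσR x h0 h1)
      have heqOn : EqOn (fun x => (∫ y in (B.y0 : ℝ)..c, f x y) + ∫ y in (c : ℝ)..B.y1, f x y)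
          (fun x => ∫ y in (B.y0 : ℝ)..B.y1, f x y) (uIcc (B.x0 : ℝ) B.x1) := by
        intro x hx
        rw [uIcc_of_le hxx] at hx
        exact hsec x hx.1 hx.2
      refine ⟨?_, ?_, fun x h0 h1 => (hσL x h0 h1).trans (hσR x h0 h1), hxL, hyL.trans hyR⟩
      · rw [KdTree2.total, ← intervalIntegral.integral_congr heqOn, intervalIntegral.integral_add hIL hIR]
        exact MI.mem_add hmL hmR
      · exact (hIL.add hIR).congr fun x hx => heqOn (uIoc_subset_uIcc hx)

/-- **Kernel obligation for leaf `i`** (prove each by its own `decide`): leaf `i` of the tree over `B` is accepted and its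
Taylor-model enclosure lies inside its claim; vacuously `true` past the last leaf.
[cite: MahboubiMelquiondSibutpinote2016, Sect. 3.3] [cite: MakinoBerz2003, Algorithm 2] -/
def leafCheckG (S : ℕ) (Ψ : ℚ → ℚ → ℚ → ℚ → EPrm → IPoly2 × Bool) (t : KdTree2) (B : Box2Q) (i : ℕ) : Bool :=
  match (t.leaves B)[i]? with
  | none => true
  | some l =>
      let e := leafEncl S Ψ l.1 l.2.1
      e.2 && decide (l.2.2.lo ≤ e.1.lo) && decide (e.1.hi ≤ l.2.2.hi)

/-- **Final obligation of an adaptive certificate**: positivity of `S`, the leaf count at most `n`, and the sum of the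
claims inside `[lo·S, hi·S]` (no Taylor model is evaluated). [cite: MahboubiMelquiondSibutpinote2016, Sect. 3.3] -/
def treeCheckG (S : ℕ) (t : KdTree2) (n : ℕ) (lo hi : ℚ) : Bool :=
  decide (0 < S) && decide (t.size ≤ n) && decide (lo * S ≤ (t.total.lo : ℚ)) && decide ((t.total.hi : ℚ) ≤ hi * S)

/-- [folklore] -/
private theorem leafClaimsOK_of_leafCheckG (S : ℕ) (Ψ : ℚ → ℚ → ℚ → ℚ → EPrm → IPoly2 × Bool) (t : KdTree2)
    (B : Box2Q) {n : ℕ} (hn : t.size ≤ n) (H : ∀ i : ℕ, i < n → leafCheckG S Ψ t B i = true) :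
    leafClaimsOK S Ψ (t.leaves B) = true := by
  unfold leafClaimsOK
  refine List.all_eq_true.2 fun l hl => ?_
  obtain ⟨i, hi, rfl⟩ := List.getElem_of_mem hl
  have hlt : i < n := lt_of_lt_of_le (by simpa [KdTree2.length_leaves] using hi) hn
  have := H i hlt
  simp only [leafCheckG, List.getElem?_eq_getElem hi] at this
  exact this

/-- **Soundness of the generic adaptive certificate**: for every jointly measurable `f` soundly modelled by `Ψ`, if every
leaf obligation holds and the final obligation holds then `lo ≤ ∫_{x0}^{x1} ∫_{y0}^{y1} f ≤ hi`.
[cite: MakinoBerz2003, Algorithm 2] [cite: MahboubiMelquiondSibutpinote2016, Sect. 3.3] -/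
theorem integral_bounds_of_leafCheckG {S : ℕ} {f : ℝ → ℝ → ℝ} (hf : Measurable fun z : ℝ × ℝ => f z.1 z.2)
    {Ψ : ℚ → ℚ → ℚ → ℚ → EPrm → IPoly2 × Bool}
    (hΨ : ∀ (h k cx cy : ℚ) (P : EPrm), 0 < S → 0 ≤ h → 0 ≤ k → (Ψ h k cx cy P).2 = true →
      TMem2 S h k (fun u v => f ((cx : ℝ) + u) ((cy : ℝ) + v)) (Ψ h k cx cy P).1)
    {t : KdTree2} {B : Box2Q} {n : ℕ} {lo hi : ℚ} (hleaf : ∀ i : ℕ, i < n → leafCheckG S Ψ t B i = true)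
    (ht : treeCheckG S t n lo hi = true) :
    (lo : ℝ) ≤ ∫ x in (B.x0 : ℝ)..B.x1, ∫ y in (B.y0 : ℝ)..B.y1, f x y ∧
      ∫ x in (B.x0 : ℝ)..B.x1, ∫ y in (B.y0 : ℝ)..B.y1, f x y ≤ (hi : ℝ) := by
  unfold treeCheckG at ht
  simp only [Bool.and_eq_true, decide_eq_true_eq] at ht
  obtain ⟨⟨⟨hS, hn⟩, hlo⟩, hhi⟩ := ht
  have hsound : ModelSound S f Ψ := fun h k cx cy P h0 k0 hok => hΨ h k cx cy P hS h0 k0 hok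
  obtain ⟨⟨h1, h2⟩, -⟩ := tree_sound hS hf hsound t B (leafClaimsOK_of_leafCheckG S Ψ t B hn hleaf)
  have hSr : (0 : ℝ) < S := by exact_mod_cast hS
  have hloR : (lo : ℝ) * S ≤ (t.total.lo : ℝ) := by exact_mod_cast hlo
  have hhiR : (t.total.hi : ℝ) ≤ (hi : ℝ) * S := by exact_mod_cast hhi
  exact ⟨le_of_mul_le_mul_right (hloR.trans h1) hSr, le_of_mul_le_mul_right (h2.trans hhiR) hSr⟩

/-! ### Part B. Adaptive certificates for `BExprE` integrands -/

/-- Kernel obligation for leaf `i`, `BExprE` integrand. [cite: MahboubiMelquiondSibutpinote2016, Sect. 3.3] -/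
def leafCheckE (S : ℕ) (E : BExprE) (t : KdTree2) (B : Box2Q) (i : ℕ) : Bool :=
  leafCheckG S (fun h k cx cy P => BExprE.model S h k P cx cy E) t B i

/-- Final obligation, `BExprE` integrand (`= treeCheckG`; the expression is not inspected).
[cite: MahboubiMelquiondSibutpinote2016, Sect. 3.3] -/
def treeCheckE (S : ℕ) (t : KdTree2) (n : ℕ) (lo hi : ℚ) : Bool := treeCheckG S t n lo hi

/-- **Soundness of the adaptive certificate for `BExprE` integrands** (no side hypotheses):
every leaf obligation and the final obligation give `lo ≤ ∫_{x0}^{x1} ∫_{y0}^{y1} E(x, y) dy dx ≤ hi`.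
[cite: MakinoBerz2003, Algorithm 2] [cite: MahboubiMelquiondSibutpinote2016, Sect. 3.3] -/
theorem integral_bounds_of_leafCheckE {S : ℕ} {E : BExprE} {t : KdTree2} {B : Box2Q} {n : ℕ} {lo hi : ℚ}
    (hleaf : ∀ i : ℕ, i < n → leafCheckE S E t B i = true) (ht : treeCheckE S t n lo hi = true) :
    (lo : ℝ) ≤ ∫ x in (B.x0 : ℝ)..B.x1, ∫ y in (B.y0 : ℝ)..B.y1, E.toFun₂ x y ∧
      ∫ x in (B.x0 : ℝ)..B.x1, ∫ y in (B.y0 : ℝ)..B.y1, E.toFun₂ x y ≤ (hi : ℝ) :=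
  integral_bounds_of_leafCheckG (BExprE.measurable_toFun₂ E)
    (fun _ _ cx cy P hS h0 k0 hok => BExprE.tmem2_model hS h0 k0 P cx cy E hok) hleaf ht

/-! ### Part C. A refinement heuristic (proposes a tree; soundness-free) -/

/-- **Refinement by bisection of the longer side**: starting from the box `B`, a box whose Taylor-model enclosure is
rejected or wider than the absolute tolerance `tol` (scaled by `S`) is bisected along its longer side, at most `depth`
times along any branch; every final box becomes a leaf with parameters `P` and its computed enclosure as claim.  The
output is only a PROPOSAL — it is certified by `leafCheckE` / `treeCheckE` (op. cit. Sect. 3.3 splits until a target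
width is met). [cite: MahboubiMelquiondSibutpinote2016, Sect. 3.3] -/
def kdRefine (S : ℕ) (E : BExprE) (P : EPrm) (tol : ℤ) : ℕ → Box2Q → KdTree2
  | 0, B => KdTree2.leaf P (leafEncl S (fun h k cx cy P => BExprE.model S h k P cx cy E) B P).1
  | d + 1, B =>
      let e := leafEncl S (fun h k cx cy P => BExprE.model S h k P cx cy E) B P
      if e.2 && decide (e.1.hi - e.1.lo ≤ tol) then KdTree2.leaf P e.1
      else if B.y1 - B.y0 ≤ B.x1 - B.x0 then
        let c := (B.x0 + B.x1) / 2
        KdTree2.splitX c (kdRefine S E P tol d ⟨B.x0, c, B.y0, B.y1⟩) (kdRefine S E P tol d ⟨c, B.x1, B.y0, B.y1⟩)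
      else
        let c := (B.y0 + B.y1) / 2
        KdTree2.splitY c (kdRefine S E P tol d ⟨B.x0, B.x1, B.y0, c⟩) (kdRefine S E P tol d ⟨B.x0, B.x1, c, B.y1⟩)

end PolyMP

end Literature.Analysis.ValidatedNumerics
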